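import Summits.BirchSwinnertonDyer.BirchSwinnertonDyer.Theorems.ManinLocalTwoThreeStevensInfinityFibreRationalAnyConstant
import Literature.NumberTheory.EllipticCurves.Gamma1ParametrizationCuspRationality
import HarnessLib

/-!
# F★ `optimalGamma1Parametrization_cusp_rational` (Conrad–Edixhoven–Stein 2003 §6.1.2 / Stevens 1982 Thm. 1.3.1) — PROVED
(route `ManinLocalTwoThree`, crux C2 stmt-BirchSwinnertonDyer-22967; cell bsd-f2-manin, prover p2 gen 23)

The tree's named Literature fact `Literature.NumberTheory.EllipticCurves.ModularForms.optimalGamma1Parametrization_cusp_rational` — for an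
optimal `X₁(N)`-datum `D` of an elliptic `W/ℚ` and `γ ∈ Γ₀(N)`, the value `π(c_D·{∞, γ∞}_f)` at the cusp `γ∞` of the `∞`-fibre is the base
change of a point of `W(ℚ)` — is the statement of `CuspValues.exists_ratPoint_eq_uniformize_smul_cuspSymbol` (p767395, which does not even use
`D.IsOptimal`): Stevens 1982 Thm. 1.3.1 (b) run on `q_N`-expansions of translates (LEAD p766634 `qExpansion_slash_conj`, p2 p767254/p767395), the
lattice-clause-free Stevens twin and descent `Fix(Aut(ℂ/ℚ)) = ℚ`.  This discharges the binder `hFstar` / `hF` of the cell's Kummer-road files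
(`…EvenKummerShimuraHolds`, `…ManinOddAtFourWitnessSplit`, …).  es g41e's HOME/es/g41/StevensGeneral-es-g41e.lean is an independent road to the
same statement (LEAD's `transport_cusp_values` generalised to an arbitrary cusp pair).

HONEST FRAMING: unconditional, fact-free; nothing about C2/C3, Manin's conjecture or BSD is proved here.  No definitions, no sorry.
[cite: ConradEdixhovenStein2003, §6.1.2 proof of Lemma 6.1.6 (p. 381) and §6.2 (p. 386)] [cite: Stevens1982, §1.3 Thm. 1.3.1 (a), (b)]
-/

set_option autoImplicit false
-- lint-debt: the directory name repeats the summit name (sibling precedent `ManinLocalTwoThreeStevensInfinityFibreRational.lean`)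
set_option linter.dupNamespace false

noncomputable section

namespace Summit.BirchSwinnertonDyer.BirchSwinnertonDyer.Theorems.ManinLocalTwoThree.CuspValues

/-- **F★ PROVED: the `X₁(N)`-parametrisation maps the cusps over `∞` to RATIONAL points** — the named fact
`optimalGamma1Parametrization_cusp_rational` verbatim (`D.IsOptimal` unused), by `exists_ratPoint_eq_uniformize_smul_cuspSymbol`.
[cite: ConradEdixhovenStein2003, §6.1.2 proof of Lemma 6.1.6 (p. 381)] [cite: Stevens1982, §1.3 Thm. 1.3.1 (a), (b)] -/
theorem optimalGamma1Parametrization_cusp_rational_holds :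
    Literature.NumberTheory.EllipticCurves.ModularForms.optimalGamma1Parametrization_cusp_rational :=
  fun _ _ _ _ D _ γ ↦ exists_ratPoint_eq_uniformize_smul_cuspSymbol D γ

end Summit.BirchSwinnertonDyer.BirchSwinnertonDyer.Theorems.ManinLocalTwoThree.CuspValues

end
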